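import Mathlib
import Summits.MatrixMultiplication.MatrixMultiplication.Theorems.GradedDesignFamily.Negative.SubfieldCellUnipotent

/-!
# (N, auxiliaries) 2×2 matrix lemmas for the normal form of `SL₂(k) →* GL₂(K)`
# (crux `LevelGradedCohnUmans.GradedDesignFamily`, stmt-MatrixMultiplication-7610; negative side,
# line `quadratic-extension-level-one-cell`, unit b2b-lgcu-subfield gen 19)

HONEST FRAMING.  Elementary `Fin 2` matrix lemmas (a determinant-one matrix fixing `e₀` is upper
unitriangular; two square-zero matrices with a common kernel vector multiply to zero; `l_x ^ p = 1`;
`w = u_1 l_{-1} u_1`) feeding `SubfieldCellNormalForm`.  Toolkit on the NEGATIVE side of the design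
stub S3; NOT summit progress.

Sorry-free. [folklore]
-/

set_option linter.dupNamespace false

open Matrix

namespace Summit.MatrixMultiplication.MatrixMultiplication.Theorems.GradedDesignFamily.Negative

section NormalFormAux

variable {K : Type} [Field K]

/-- `X e₀ = (X₀₀, X₁₀)`. [folklore] -/
theorem fin_two_mulVec_e0 (X : Matrix (Fin 2) (Fin 2) K) : X *ᵥ ![1, 0] = ![X 0 0, X 1 0] := by
  ext i; fin_cases i <;> simp [Matrix.mulVec, dotProduct, Fin.sum_univ_two]

/-- `X e₁ = (X₀₁, X₁₁)`. [folklore] -/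
theorem fin_two_mulVec_e1 (X : Matrix (Fin 2) (Fin 2) K) : X *ᵥ ![0, 1] = ![X 0 1, X 1 1] := by
  ext i; fin_cases i <;> simp [Matrix.mulVec, dotProduct, Fin.sum_univ_two]

/-- A determinant-one matrix fixing `e₀` is upper unitriangular. [folklore] -/
theorem fin_two_eq_upper_of_fix (X : Matrix (Fin 2) (Fin 2) K) (h : X *ᵥ ![1, 0] = ![1, 0])
    (hdet : X.det = 1) : X = !![1, X 0 1; 0, 1] := by
  rw [fin_two_mulVec_e0] at h
  have h0 : X 0 0 = 1 := by have := congr_fun h 0; simpa using this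
  have h1 : X 1 0 = 0 := by have := congr_fun h 1; simpa using this
  have h2 : X 1 1 = 1 := by rw [Matrix.det_fin_two, h0, h1] at hdet; simpa using hdet
  ext i j; fin_cases i <;> fin_cases j <;> simp [h0, h1, h2]

/-- A determinant-one matrix fixing `e₁` is lower unitriangular. [folklore] -/
theorem fin_two_eq_lower_of_fix (X : Matrix (Fin 2) (Fin 2) K) (h : X *ᵥ ![0, 1] = ![0, 1])
    (hdet : X.det = 1) : X = !![1, 0; X 1 0, 1] := by
  rw [fin_two_mulVec_e1] at h
  have h0 : X 0 1 = 0 := by have := congr_fun h 0; simpa using this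
  have h1 : X 1 1 = 1 := by have := congr_fun h 1; simpa using this
  have h2 : X 0 0 = 1 := by rw [Matrix.det_fin_two, h0, h1] at hdet; simpa using hdet
  ext i j; fin_cases i <;> fin_cases j <;> simp [h0, h1, h2]

/-- If `M² = 0` and `N`, `M` kill a common non-zero vector then `N M = 0`. [folklore] -/
theorem fin_two_mul_eq_zero_of_common_ker (N M : Matrix (Fin 2) (Fin 2) K) (hM : M * M = 0)
    (v : Fin 2 → K) (hv : v ≠ 0) (hNv : N *ᵥ v = 0) (hMv : M *ᵥ v = 0) : N * M = 0 := by
  classical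
  by_cases hM0 : M = 0
  · rw [hM0, mul_zero]
  have key : ∀ w, (N * M) *ᵥ w = 0 := by
    intro w
    have hMw : M *ᵥ (M *ᵥ w) = 0 := by rw [Matrix.mulVec_mulVec, hM, Matrix.zero_mulVec]
    obtain ⟨c, hc⟩ := fin_two_exists_smul_of_mulVec_eq_zero M hM0 v (M *ᵥ w) hv hMv hMw
    rw [← Matrix.mulVec_mulVec, hc, Matrix.mulVec_smul, hNv, smul_zero]
  ext i j
  have := congr_fun (key (Pi.single j 1)) i
  rw [Matrix.mulVec_single_one] at this
  simpa using this

end NormalFormAux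

section NormalForm

variable {k K : Type} [Field k] [Fintype k] [DecidableEq k] [Field K] [Fintype K] [DecidableEq K]

omit [DecidableEq k] [DecidableEq K] in
/-- `(φ(l_x) - 1)² = 0` for a hom `φ : SL₂(k) →* GL₂(K)`, `|K| = |k|²` (the lower unipotent `l_x` is a
Weyl-conjugate of `u_{-x}`, hence has order `p`). [folklore] -/
theorem subfieldCell_lower_sub_one_sq
    (φ : Matrix.SpecialLinearGroup (Fin 2) k →* Matrix.GeneralLinearGroup (Fin 2) K)
    (hK : Fintype.card K = Fintype.card k ^ 2) (x : k) :
    (((φ ⟨_, sl2md_det_lower x⟩ : Matrix.GeneralLinearGroup (Fin 2) K) :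
        Matrix (Fin 2) (Fin 2) K) - 1) *
      (((φ ⟨_, sl2md_det_lower x⟩ : Matrix.GeneralLinearGroup (Fin 2) K) :
        Matrix (Fin 2) (Fin 2) K) - 1) = 0 := by
  have e : (⟨_, sl2md_det_weyl⟩ * ⟨_, sl2md_det_upper (-x)⟩ * ⟨_, sl2md_det_weyl⟩⁻¹ :
      Matrix.SpecialLinearGroup (Fin 2) k) = ⟨_, sl2md_det_lower x⟩ := by
    rw [mul_inv_eq_iff_eq_mul, sl2md_weyl_mul_upper]
  refine subfieldCell_sub_one_sq_of_pow_char φ hK _ ?_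
  rw [← e, conj_pow, subfieldCell_upper_pow_char, mul_one, mul_inv_cancel]

/-- `w = u_1 l_{-1} u_1` in `SL₂`. [folklore] -/
theorem sl2md_weyl_eq (k : Type) [Field k] :
    (⟨_, sl2md_det_upper (1 : k)⟩ * ⟨_, sl2md_det_lower (-1 : k)⟩ * ⟨_, sl2md_det_upper (1 : k)⟩ :
      Matrix.SpecialLinearGroup (Fin 2) k) = ⟨_, sl2md_det_weyl⟩ := by
  refine Matrix.SpecialLinearGroup.ext _ _ fun i j => ?_
  rw [Matrix.SpecialLinearGroup.coe_mul, Matrix.SpecialLinearGroup.coe_mul]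
  fin_cases i <;> fin_cases j <;> simp [Matrix.mul_apply, Fin.sum_univ_two]

end NormalForm

end Summit.MatrixMultiplication.MatrixMultiplication.Theorems.GradedDesignFamily.Negative
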